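import Literature.NumberTheory.EllipticCurves.HeightsProofs
import Mathlib.NumberTheory.Height.NumberField
import Mathlib.NumberTheory.NumberField.Basic
import Mathlib.RingTheory.Ideal.Norm.RelNorm
import Mathlib.FieldTheory.PrimitiveElement
import Mathlib.RingTheory.Localization.Integer
import HarnessLib

/-!
# Heights under base change (proved): `H_L(x) = H_K(x)^{[L:K]}` and `ĥ_L = [L:K] · ĥ_K`

Trunk `TranscendEllArithS` (G06), companion to `Literature.NumberTheory.EllipticCurves.Heights`
(named facts) and `…HeightsProofs` (their discharges). This file contains **theorems only**
(no new definitions, no named facts): the behaviour of Mathlib's relative heights and of the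
tree's naive/canonical heights on `E(K)` under a finite extension of number fields `L/K`.

## Main results

* `NumberField.mulHeight_comp_algebraMap`: for a tuple `x : ι → K`,
  `mulHeight (algebraMap K L ∘ x) = mulHeight x ^ [L:K]`;
  `NumberField.mulHeight₁_algebraMap`, `NumberField.logHeight₁_algebraMap`
  (`h_L(x) = [L:K] · h_K(x)`), and the ring-homomorphism forms
  `NumberField.logHeight₁_map_ringHom` (`[K:ℚ] · h_L(f x) = [L:ℚ] · h_K(x)`, i.e. the *absolute*
  height `h_K / [K:ℚ]` does not depend on the field).
* `WeierstrassCurve.Affine.Point.naiveHeight_baseChange`,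
  `WeierstrassCurve.Affine.Point.canonicalHeight_baseChange`,
  `WeierstrassCurve.Affine.Point.heightPairing_baseChange`: for `W/R`, number fields `K ⊆ L`
  over `R` and `P ∈ E(K)`, `h_L(P) = [L:K] h_K(P)`, `ĥ_L(P) = [L:K] ĥ_K(P)`,
  `⟨P, Q⟩_L = [L:K] ⟨P, Q⟩_K` (the last two for `W` elliptic, where Tate's limit exists:
  `tendsto_canonicalHeight_holds`); and the forms along an arbitrary algebra map
  `f : K →ₐ[S] L` (`naiveHeight_map`, `canonicalHeight_map`), in particular the Galois
  invariance `ĥ(σ P) = ĥ(P)` for `σ : K →ₐ[S] K` (`canonicalHeight_map_self`,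
  `heightPairing_map_self`; field level `NumberField.logHeight₁_map_ringHom_self`).

These are the statements printed as Silverman, *The Arithmetic of Elliptic Curves*, GTM 106
(2nd ed. 2009), Prop. VIII.5.4(b) (`H_L(P) = H_K(P)^{[L:K]}` for `P ∈ ℙⁿ(K)`) and, for the
absolute height, Bombieri–Gubler, *Heights in Diophantine Geometry* (2006), Lemma 1.5.2
("`h(𝐱)` is independent of the choice of `K`") and Prop. 1.5.17 (`h(P) = h(σ(P))`, Galois
invariance); the consequence `ĥ_L = [L:K] ĥ_K` for the
relative Néron–Tate height is the normalisation remark used throughout Gross–Zagier 1986 (heights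
over the Hilbert class field `H` versus over `K`: `ĥ_H = [H:K] ĥ_K`, cf. the docstring of
`Literature.NumberTheory.EllipticCurves.GrossZagierFormula`).

## Proof

Mathlib normalises the height of a number field `K` with the infinite places weighted by
`mult` and the finite places `‖·‖_v = Nv^{-ord_v}` (`NumberField.instAdmissibleAbsValues`,
`NumberField.mulHeight_eq`). After clearing denominators (`mulHeight` is projective), for an
integral tuple `x : ι → 𝓞 K`:
* archimedean part: `∏_w (⨆ᵢ w(xᵢ))^{mult w} = ∏_{φ : L →+* ℂ} ⨆ᵢ ‖φ xᵢ‖`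
  (`InfinitePlace.card_filter_mk_eq`), and every `ψ : K →+* ℂ` has exactly `[L:K]` extensions
  to `L` (`AlgHom.card`), whence the factor `^[L:K]`;
* non-archimedean part: `∏ᶠ_v ⨆ᵢ ‖xᵢ‖_v = N(⟨xᵢ⟩)⁻¹`
  (`NumberField.absNorm_mul_finprod_finitePlace_eq_one`) and
  `N(𝔞 𝓞_L) = N(𝔞)^{[L:K]}` (`Ideal.absNorm_algebraMap`).

## References

* J. H. Silverman, *The Arithmetic of Elliptic Curves*, GTM 106, 2nd ed. (2009), Prop. VIII.5.4,
  Thm. VIII.9.3.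
* E. Bombieri, W. Gubler, *Heights in Diophantine Geometry*, New Mathematical Monographs 4,
  CUP (2006), §1.3.12–1.3.13, Lemma 1.5.2 and Prop. 1.5.17 (bib key `BombieriGubler2001`, the
  key issued by the literature store for doi:10.1017/cbo9780511542879).
* B. Gross, D. Zagier, *Heegner points and derivatives of `L`-series*, Invent. Math. 84 (1986),
  I.§6 (normalisation of `ĥ` over `H` and over `K`).
-/

noncomputable section

open scoped Classical

namespace NumberField

open Height Module Finset

variable {K L : Type*} [Field K] [NumberField K] [Field L] [NumberField L] [Algebra K L]

/-! ### Embeddings of `L` restricting to a given embedding of `K` -/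

/-- Every complex embedding `ψ` of `K` has exactly `[L:K]` extensions to `L`
(the `K`-algebra homomorphisms `L →ₐ[K] ℂ` for the `K`-algebra structure `ψ` on `ℂ`;
`AlgHom.card`: a finite separable extension of degree `n` has exactly `n` embeddings over `K`
into an algebraically closed field). [folklore] -/
theorem card_filter_comp_algebraMap_eq (ψ : K →+* ℂ) :
    #{φ : L →+* ℂ | φ.comp (algebraMap K L) = ψ} = finrank K L := by
  letI : Algebra K ℂ := ψ.toAlgebra
  let e : {φ : L →+* ℂ // φ.comp (algebraMap K L) = ψ} ≃ (L →ₐ[K] ℂ) :=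
    { toFun := fun φ => { (φ.1 : L →+* ℂ) with commutes' := fun k => RingHom.congr_fun φ.2 k }
      invFun := fun g => ⟨g.toRingHom, RingHom.ext fun k => g.commutes k⟩
      left_inv := fun φ => by ext; rfl
      right_inv := fun g => by ext; rfl }
  rw [← Fintype.card_subtype, Fintype.card_congr e, AlgHom.card K L ℂ]

/-- A product over the complex embeddings of `L` of a quantity depending only on the restriction
to `K` is the `[L:K]`-th power of the product over the embeddings of `K`. [folklore] -/
theorem prod_embeddings_comp_algebraMap {M : Type*} [CommMonoid M] (F : (K →+* ℂ) → M) :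
    ∏ φ : L →+* ℂ, F (φ.comp (algebraMap K L)) = (∏ ψ : K →+* ℂ, F ψ) ^ finrank K L := by
  rw [← prod_fiberwise_of_maps_to (s := (univ : Finset (L →+* ℂ)))
      (t := (univ : Finset (K →+* ℂ))) (g := fun φ : L →+* ℂ => φ.comp (algebraMap K L))
      (fun _ _ => mem_univ _), ← prod_pow]
  refine prod_congr rfl fun ψ _ => ?_
  rw [prod_congr rfl fun φ hφ => by rw [(mem_filter.mp hφ).2], prod_const,
    card_filter_comp_algebraMap_eq]

/-- A product over the infinite places weighted by `mult` is the corresponding product over the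
complex embeddings (`InfinitePlace.card_filter_mk_eq`). [folklore] -/
theorem prod_infinitePlace_pow_mult_eq_prod_embeddings {M : Type*} [CommMonoid M]
    (g : InfinitePlace K → M) :
    ∏ w : InfinitePlace K, g w ^ w.mult = ∏ φ : K →+* ℂ, g (InfinitePlace.mk φ) := by
  rw [← prod_fiberwise_of_maps_to (s := (univ : Finset (K →+* ℂ)))
      (t := (univ : Finset (InfinitePlace K))) (g := fun φ : K →+* ℂ => InfinitePlace.mk φ)
      (fun _ _ => mem_univ _)]
  refine prod_congr rfl fun w _ => ?_
  rw [prod_congr rfl fun φ hφ => by rw [(mem_filter.mp hφ).2], prod_const,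
    InfinitePlace.card_filter_mk_eq]

/-! ### The archimedean and non-archimedean parts of the height under base change -/

/-- Archimedean part: `∏_{w ∣ ∞} (⨆ᵢ |xᵢ|_w)^{mult w}` over `L` is the `[L:K]`-th power of the
same product over `K`, for a tuple `x` with entries in `K`. [folklore] -/
theorem prod_infinitePlace_iSup_comp_algebraMap {ι : Type*} (x : ι → K) :
    ∏ w : InfinitePlace L, (⨆ i, w (algebraMap K L (x i))) ^ w.mult =
      (∏ v : InfinitePlace K, (⨆ i, v (x i)) ^ v.mult) ^ finrank K L := by
  rw [prod_infinitePlace_pow_mult_eq_prod_embeddings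
      (fun w : InfinitePlace L => ⨆ i, w (algebraMap K L (x i))),
    prod_infinitePlace_pow_mult_eq_prod_embeddings (fun v : InfinitePlace K => ⨆ i, v (x i)),
    ← prod_embeddings_comp_algebraMap (fun ψ : K →+* ℂ => ⨆ i, (InfinitePlace.mk ψ) (x i))]
  simp only [InfinitePlace.apply, RingHom.comp_apply]

/-- Non-archimedean part: for a non-zero tuple of algebraic integers `x : ι → 𝓞 K`,
`∏ᶠ_{w ∤ ∞} ⨆ᵢ ‖xᵢ‖_w` over `L` is the `[L:K]`-th power of the same product over `K`
(both are the inverse of the norm of the ideal `⟨xᵢ⟩`, and `N(𝔞𝓞_L) = N(𝔞)^{[L:K]}`).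
[folklore] -/
theorem finprod_finitePlace_iSup_comp_algebraMap {ι : Type*} [Finite ι] {x : ι → 𝓞 K}
    (hx : x ≠ 0) :
    ∏ᶠ w : FinitePlace L, (⨆ i, w (algebraMap K L (x i))) =
      (∏ᶠ v : FinitePlace K, ⨆ i, v (x i)) ^ finrank K L := by
  have hy : (fun i => algebraMap (𝓞 K) (𝓞 L) (x i)) ≠ 0 := by
    intro h
    apply hx
    funext i
    have hi := congrFun h i
    simp only [Pi.zero_apply] at hi
    exact (map_eq_zero_iff _ (RingOfIntegers.algebraMap.injective K L)).mp hi
  have hK := absNorm_mul_finprod_finitePlace_eq_one hx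
  have hL := absNorm_mul_finprod_finitePlace_eq_one hy
  have hco : ∀ i, ((algebraMap (𝓞 K) (𝓞 L) (x i) : 𝓞 L) : L) = algebraMap K L (x i) :=
    fun i => rfl
  simp only [hco] at hL
  have hspan : Ideal.span (Set.range fun i => algebraMap (𝓞 K) (𝓞 L) (x i)) =
      (Ideal.span (Set.range x)).map (algebraMap (𝓞 K) (𝓞 L)) := by
    rw [Ideal.map_span, ← Set.range_comp]
    rfl
  have hN : ((Ideal.span (Set.range fun i => algebraMap (𝓞 K) (𝓞 L) (x i))).absNorm : ℝ) =
      ((Ideal.span (Set.range x)).absNorm : ℝ) ^ finrank K L := by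
    rw [hspan, Ideal.absNorm_algebraMap, Nat.cast_pow]
    congr 1
    letI := FractionRing.liftAlgebra (𝓞 K) (FractionRing (𝓞 L))
    exact Algebra.finrank_eq_of_equiv_equiv (FractionRing.algEquiv (𝓞 K) K).toRingEquiv
      (FractionRing.algEquiv (𝓞 L) L).toRingEquiv (by
        ext z
        exact IsFractionRing.algEquiv_commutes (FractionRing.algEquiv (𝓞 K) K)
          (FractionRing.algEquiv (𝓞 L) L) z)
  rw [eq_inv_of_mul_eq_one_right hL, eq_inv_of_mul_eq_one_right hK, hN, inv_pow]

/-! ### Heights under base change -/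

/-- **Relative heights under base change** (Silverman, AEC Prop. VIII.5.4(b):
`H_L(P) = H_K(P)^{[L:K]}` for `P ∈ ℙⁿ(K)`; Bombieri–Gubler 2006, Lemma 1.5.2 for the absolute
height). For a tuple `x` of elements of a number field `K` and a finite extension `L/K`,
Mathlib's multiplicative height satisfies `mulHeight (algebraMap K L ∘ x) = mulHeight x ^ [L:K]`.
[cite: SilvermanAEC2009, Prop. VIII.5.4(b)] -/
theorem mulHeight_comp_algebraMap {ι : Type*} [Finite ι] (x : ι → K) :
    mulHeight (algebraMap K L ∘ x) = mulHeight x ^ finrank K L := by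
  rcases eq_or_ne x 0 with rfl | hx
  · have : ((algebraMap K L) ∘ (0 : ι → K)) = 0 := by
      funext i
      simp
    rw [this, mulHeight_zero, mulHeight_zero, one_pow]
  -- clear denominators: `b • x = y` with `y` integral
  obtain ⟨b, hb⟩ := IsLocalization.exist_integer_multiples_of_finite (nonZeroDivisors (𝓞 K)) x
  choose y hy using hb
  have hb0 : (algebraMap (𝓞 K) K (b : 𝓞 K)) ≠ 0 :=
    RingOfIntegers.coe_ne_zero_iff.mpr (nonZeroDivisors.coe_ne_zero b)
  have hxy : (algebraMap (𝓞 K) K (b : 𝓞 K)) • x = fun i => ((y i : 𝓞 K) : K) := by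
    funext i
    rw [Pi.smul_apply, smul_eq_mul, ← Algebra.smul_def, ← hy i]
  have hy0 : y ≠ 0 := by
    rintro rfl
    apply hx
    have h2 : (algebraMap (𝓞 K) K (b : 𝓞 K)) • x = 0 := by
      rw [hxy]
      funext i
      simp
    exact (smul_eq_zero.mp h2).resolve_left hb0
  have hyK : (fun i => ((y i : 𝓞 K) : K)) ≠ 0 := by
    intro h
    apply hy0
    funext i
    have hi := congrFun h i
    simpa using hi
  have hyL : (fun i => algebraMap K L ((y i : 𝓞 K) : K)) ≠ 0 := by
    intro h
    apply hyK
    funext i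
    have hi := congrFun h i
    simpa using hi
  have h1 : mulHeight x = mulHeight (fun i => ((y i : 𝓞 K) : K)) := by
    rw [← mulHeight_smul_eq_mulHeight x hb0, hxy]
  have h2 : mulHeight (algebraMap K L ∘ x) =
      mulHeight (fun i => algebraMap K L ((y i : 𝓞 K) : K)) := by
    rw [← mulHeight_smul_eq_mulHeight _ ((map_ne_zero (algebraMap K L)).mpr hb0)]
    congr 1
    funext i
    have hi := congrFun hxy i
    simp only [Pi.smul_apply, smul_eq_mul] at hi
    simp only [Pi.smul_apply, Function.comp_apply, smul_eq_mul, ← map_mul, hi]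
  rw [h1, h2, NumberField.mulHeight_eq hyL, NumberField.mulHeight_eq hyK, mul_pow,
    prod_infinitePlace_iSup_comp_algebraMap, finprod_finitePlace_iSup_comp_algebraMap hy0]

/-- `logHeight (algebraMap K L ∘ x) = [L:K] · logHeight x` (Silverman, AEC Prop. VIII.5.4(b),
logarithmic form). [cite: SilvermanAEC2009, Prop. VIII.5.4(b)] -/
theorem logHeight_comp_algebraMap {ι : Type*} [Finite ι] (x : ι → K) :
    logHeight (algebraMap K L ∘ x) = finrank K L * logHeight x := by
  rw [logHeight_eq_log_mulHeight, mulHeight_comp_algebraMap, Real.log_pow,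
    logHeight_eq_log_mulHeight]

/-- `H_L(x) = H_K(x)^{[L:K]}` for the height of a field element (Silverman, AEC
Prop. VIII.5.4(b) with `P = (x : 1)`). [cite: SilvermanAEC2009, Prop. VIII.5.4(b)] -/
theorem mulHeight₁_algebraMap (x : K) :
    mulHeight₁ (algebraMap K L x) = mulHeight₁ x ^ finrank K L := by
  rw [mulHeight₁_eq_mulHeight, mulHeight₁_eq_mulHeight, ← mulHeight_comp_algebraMap]
  congr 1
  funext i
  fin_cases i <;> simp

/-- `h_L(x) = [L:K] · h_K(x)` for the logarithmic height of a field element (Silverman, AEC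
Prop. VIII.5.4(b)). [cite: SilvermanAEC2009, Prop. VIII.5.4(b)] -/
theorem logHeight₁_algebraMap (x : K) :
    logHeight₁ (algebraMap K L x) = finrank K L * logHeight₁ x := by
  rw [logHeight₁_eq_log_mulHeight₁, mulHeight₁_algebraMap, Real.log_pow,
    logHeight₁_eq_log_mulHeight₁]

omit [Algebra K L] in
/-- Ring-homomorphism form: for any `f : K →+* L` of number fields,
`H_L(f x)^{[K:ℚ]} = H_K(x)^{[L:ℚ]}` (tower law `[L:ℚ] = [L:K][K:ℚ]`).
[cite: SilvermanAEC2009, Prop. VIII.5.4(b)] -/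
theorem mulHeight₁_map_ringHom_pow (f : K →+* L) (x : K) :
    mulHeight₁ (f x) ^ finrank ℚ K = mulHeight₁ x ^ finrank ℚ L := by
  letI : Algebra K L := f.toAlgebra
  haveI : IsScalarTower ℚ K L := IsScalarTower.of_algebraMap_eq fun q => by simp
  rw [← Module.finrank_mul_finrank ℚ K L, pow_mul', ← mulHeight₁_algebraMap]
  rfl

omit [Algebra K L] in
/-- **Independence of the absolute height of the field** (Bombieri–Gubler 2006, Lemma 1.5.2;
Silverman, AEC Prop. VIII.5.4(b)): for any `f : K →+* L` of number fields,
`[K:ℚ] · h_L(f x) = [L:ℚ] · h_K(x)`, i.e. `h_L(f x)/[L:ℚ] = h_K(x)/[K:ℚ]`.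
[cite: SilvermanAEC2009, Prop. VIII.5.4(b)] -/
theorem logHeight₁_map_ringHom (f : K →+* L) (x : K) :
    finrank ℚ K * logHeight₁ (f x) = finrank ℚ L * logHeight₁ x := by
  have h := congrArg Real.log (mulHeight₁_map_ringHom_pow f x)
  rwa [Real.log_pow, Real.log_pow, ← logHeight₁_eq_log_mulHeight₁,
    ← logHeight₁_eq_log_mulHeight₁] at h

omit [Algebra K L] in
/-- **Invariance of the height under field endomorphisms** (Galois conjugation): for any
`σ : K →+* K` of a number field, `H_K(σ x) = H_K(x)` (Bombieri–Gubler 2006, Prop. 1.5.17: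
`h(P) = h(σ(P))`; here from `H_K(σ x)^{[K:ℚ]} = H_K(x)^{[K:ℚ]}`).
[cite: BombieriGubler2001, Prop. 1.5.17] -/
theorem mulHeight₁_map_ringHom_self (σ : K →+* K) (x : K) : mulHeight₁ (σ x) = mulHeight₁ x :=
  (pow_left_inj₀ (mulHeight₁_pos _).le (mulHeight₁_pos _).le Module.finrank_pos.ne').mp
    (mulHeight₁_map_ringHom_pow σ x)

omit [Algebra K L] in
/-- `h_K(σ x) = h_K(x)` for any `σ : K →+* K` of a number field (Bombieri–Gubler 2006,
Prop. 1.5.17, logarithmic form). [cite: BombieriGubler2001, Prop. 1.5.17] -/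
theorem logHeight₁_map_ringHom_self (σ : K →+* K) (x : K) : logHeight₁ (σ x) = logHeight₁ x := by
  rw [logHeight₁_eq_log_mulHeight₁, mulHeight₁_map_ringHom_self, logHeight₁_eq_log_mulHeight₁]

end NumberField

/-! ### Naive and canonical heights on `E(K)` under base change -/

namespace WeierstrassCurve.Affine.Point

open Filter Topology Module

section baseChange

variable {R : Type*} [CommRing R] {W : WeierstrassCurve R} {K L : Type*} [Field K] [NumberField K]
  [Field L] [NumberField L] [Algebra R K] [Algebra R L] [Algebra K L] [IsScalarTower R K L]

/-- **Naive height under base change**: for `P ∈ E(K)` and a finite extension `L/K`,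
`h_L(P) = [L:K] · h_K(P)` (the `x`-coordinate is unchanged; Silverman, AEC Prop. VIII.5.4(b)).
[cite: SilvermanAEC2009, Prop. VIII.5.4(b)] -/
theorem naiveHeight_baseChange (P : (W.baseChange K).toAffine.Point) :
    naiveHeight (baseChange K L P) = finrank K L * naiveHeight P := by
  cases P with
  | zero => rw [← zero_def, map_zero, naiveHeight_zero, naiveHeight_zero, mul_zero]
  | some x y h =>
    rw [baseChange, map_some, naiveHeight_some, naiveHeight_some]
    exact NumberField.logHeight₁_algebraMap x

/-- **Canonical height under base change**: for an elliptic curve, `P ∈ E(K)` and a finite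
extension `L/K`, `ĥ_L(P) = [L:K] · ĥ_K(P)` (Tate's limit of `naiveHeight_baseChange`; the limit
exists by `tendsto_canonicalHeight_holds`). This is the normalisation relation `ĥ_H = [H:K] ĥ_K`
between the heights over the Hilbert class field and over `K` in Gross–Zagier 1986, I.§6.
Silverman, AEC Prop. VIII.5.4(b) with Prop. VIII.9.1. [cite: SilvermanAEC2009, Prop. VIII.9.1] -/
theorem canonicalHeight_baseChange [W.IsElliptic] (P : (W.baseChange K).toAffine.Point) :
    canonicalHeight (baseChange K L P) = finrank K L * canonicalHeight P := by
  haveI : (W.baseChange K).IsElliptic := inferInstanceAs (W.map (algebraMap R K)).IsElliptic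
  have hP := tendsto_canonicalHeight_holds P
  have h : (fun n : ℕ => naiveHeight ((2 ^ n) • baseChange K L P) / 4 ^ n) =
      fun n : ℕ => (finrank K L : ℝ) * (naiveHeight ((2 ^ n) • P) / 4 ^ n) := by
    funext n
    rw [← map_nsmul, naiveHeight_baseChange]
    ring
  rw [canonicalHeight, h]
  exact (hP.const_mul _).limUnder_eq

/-- **Height pairing under base change**: `⟨P, Q⟩_L = [L:K] · ⟨P, Q⟩_K` for an elliptic curve
and a finite extension `L/K` of number fields. Silverman, AEC Thm. VIII.9.3 with
Prop. VIII.5.4(b). [cite: SilvermanAEC2009, Prop. VIII.5.4(b)] -/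
theorem heightPairing_baseChange [W.IsElliptic] (P Q : (W.baseChange K).toAffine.Point) :
    heightPairing (baseChange K L P) (baseChange K L Q) = finrank K L * heightPairing P Q := by
  simp only [heightPairing, ← map_add, canonicalHeight_baseChange]
  ring

end baseChange

section map

variable {R S : Type*} [CommRing R] [CommRing S] [Algebra R S] {W : WeierstrassCurve R}
  {K L : Type*} [Field K] [NumberField K] [Field L] [NumberField L]
  [Algebra R K] [Algebra S K] [IsScalarTower R S K] [Algebra R L] [Algebra S L]
  [IsScalarTower R S L] (f : K →ₐ[S] L)

/-- Naive height along an algebra map `f : K →ₐ[S] L` of number fields (e.g. an embedding of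
`K` into a bigger number field, as in `Literature.NumberTheory.EllipticCurves.IsHeegnerPoint`):
`[K:ℚ] · h_L(f P) = [L:ℚ] · h_K(P)`. Silverman, AEC Prop. VIII.5.4(b).
[cite: SilvermanAEC2009, Prop. VIII.5.4(b)] -/
theorem naiveHeight_map (P : (W.baseChange K).toAffine.Point) :
    finrank ℚ K * naiveHeight (map f P) = finrank ℚ L * naiveHeight P := by
  cases P with
  | zero => rw [← zero_def, map_zero, naiveHeight_zero, naiveHeight_zero, mul_zero, mul_zero]
  | some x y h =>
    rw [map_some, naiveHeight_some, naiveHeight_some]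
    exact NumberField.logHeight₁_map_ringHom f.toRingHom x

/-- Canonical height along an algebra map `f : K →ₐ[S] L` of number fields, for an elliptic
curve: `[K:ℚ] · ĥ_L(f P) = [L:ℚ] · ĥ_K(P)`. Silverman, AEC Prop. VIII.5.4(b) with
Prop. VIII.9.1. [cite: SilvermanAEC2009, Prop. VIII.9.1] -/
theorem canonicalHeight_map [W.IsElliptic] (P : (W.baseChange K).toAffine.Point) :
    finrank ℚ K * canonicalHeight (map f P) = finrank ℚ L * canonicalHeight P := by
  haveI : (W.baseChange K).IsElliptic := inferInstanceAs (W.map (algebraMap R K)).IsElliptic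
  have hK : (finrank ℚ K : ℝ) ≠ 0 := Nat.cast_ne_zero.mpr Module.finrank_pos.ne'
  have key (Q : (W.baseChange K).toAffine.Point) :
      naiveHeight (map f Q) = (finrank ℚ L : ℝ) / finrank ℚ K * naiveHeight Q := by
    have hQ := naiveHeight_map f Q
    calc naiveHeight (map f Q)
        = (finrank ℚ K : ℝ)⁻¹ * ((finrank ℚ K : ℝ) * naiveHeight (map f Q)) := by
          rw [← mul_assoc, inv_mul_cancel₀ hK, one_mul]
      _ = (finrank ℚ L : ℝ) / finrank ℚ K * naiveHeight Q := by
          rw [hQ]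
          ring
  have hP := tendsto_canonicalHeight_holds P
  have h : (fun n : ℕ => naiveHeight ((2 ^ n) • map f P) / 4 ^ n) =
      fun n : ℕ => ((finrank ℚ L : ℝ) / finrank ℚ K) * (naiveHeight ((2 ^ n) • P) / 4 ^ n) := by
    funext n
    rw [← map_nsmul, key]
    ring
  have hlim : canonicalHeight (map f P) =
      (finrank ℚ L : ℝ) / finrank ℚ K * canonicalHeight P := by
    rw [canonicalHeight, h]
    exact (hP.const_mul _).limUnder_eq
  rw [hlim, ← mul_assoc, mul_div_assoc', mul_div_cancel_left₀ _ hK]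

/-- **Galois invariance of the naive height on `E(K)`**: for an algebra endomorphism
`σ : K →ₐ[S] K` of the number field `K` (e.g. `σ ∈ Gal(K/S)`), `h(σ P) = h(P)`
(Bombieri–Gubler 2006, Prop. 1.5.17, applied to `x(P)`). [cite: BombieriGubler2001, Prop. 1.5.17] -/
theorem naiveHeight_map_self (σ : K →ₐ[S] K) (P : (W.baseChange K).toAffine.Point) :
    naiveHeight (map σ P) = naiveHeight P := by
  cases P with
  | zero => rw [← zero_def, map_zero]
  | some x y h =>
    rw [map_some, naiveHeight_some, naiveHeight_some]
    exact NumberField.logHeight₁_map_ringHom_self σ.toRingHom x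

/-- **Galois invariance of the canonical height**: for an elliptic curve and an algebra
endomorphism `σ : K →ₐ[S] K` of the number field `K`, `ĥ(σ P) = ĥ(P)` — the relation
`ĥ(c^σ) = ĥ(c)`, `σ ∈ Gal(H/K)`, used for the Heegner divisor over the Hilbert class field in
Gross–Zagier 1986, I.§6 (Bombieri–Gubler 2006, Prop. 1.5.17 with Tate's limit,
Silverman AEC Prop. VIII.9.1). [cite: BombieriGubler2001, Prop. 1.5.17] -/
theorem canonicalHeight_map_self [W.IsElliptic] (σ : K →ₐ[S] K)
    (P : (W.baseChange K).toAffine.Point) : canonicalHeight (map σ P) = canonicalHeight P := by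
  have hK : (finrank ℚ K : ℝ) ≠ 0 := Nat.cast_ne_zero.mpr Module.finrank_pos.ne'
  exact mul_left_cancel₀ hK (canonicalHeight_map σ P)

/-- Galois invariance of the height pairing: `⟨σ P, σ Q⟩ = ⟨P, Q⟩` for an algebra endomorphism
`σ : K →ₐ[S] K` (Bombieri–Gubler 2006, Prop. 1.5.17; Silverman AEC Thm. VIII.9.3).
[cite: BombieriGubler2001, Prop. 1.5.17] -/
theorem heightPairing_map_self [W.IsElliptic] (σ : K →ₐ[S] K)
    (P Q : (W.baseChange K).toAffine.Point) :
    heightPairing (map σ P) (map σ Q) = heightPairing P Q := by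
  simp only [heightPairing, ← map_add, canonicalHeight_map_self]

end map

end WeierstrassCurve.Affine.Point

end
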